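import Literature.NumberTheory.Automorphic.ArchCartanCoordinates      -- ★ (COORD): `RegS`, `RegG`
import Mathlib.Topology.Algebra.Module.Cardinality
import Mathlib.Topology.ExtendFrom
import HarnessLib

/-!
# The regular set `RegS S` of the `H`-Cartan charts is DENSE in the coordinate space (so `extendFrom (RegS S)` reads genuine limits at every wall point)
# (Shelstad 1979 §4 p. 22 «`T_reg` dense open»; Bouaziz 1994 §3.1 p. 579; Rogawski 1990 §8.2 p. 122 «as `ψ → 0`»)

Topic `NumberTheory/Automorphic`; namespace `Literature.NumberTheory.Automorphic.ArchCartan`.  THEOREMS ONLY (no `def`, no instance, no notation, no axiom, no named fact, no `sorry`).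
Cell `pub/hodgecm-mathlib`, line LH3 (closer stub `stub_N9`, crux H413 = `stmt-HodgeConjecture-24833`); organ **(REG-DENSE)** of the LH3 direct road (LH3-p01 (g3) DEFAULT 2026-09-02 ≈06:35Z;
the `G′`-side twin `dense_regG` ∕ `mem_closure_regG` is ★ `Rogawski1990/ArchTransfFamilySymmetries` (LH7-p02 (g2)) — not restated here).  Author LH3-p01 (g3).

WHY.  The chart families of the direct road (★ `bzExtend`, ★ `bzExtendG`) extend functions given on the regular sets `RegS S` ∕ `RegG S′` to the walls with Mathlib's `extendFrom`, whose value at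
`c` is a genuine limit exactly when `𝓝[regular set] c` is non-trivial, i.e. when `c` lies in the CLOSURE of the regular set.  This file proves that closure is everything on the `H` side.
PROOF.  Along the line `t ↦ c + t • v` with the uniform direction `v w = (3, 1, 2)` (angles moving at pairwise different rates never stay coincident: `circleExp_add_mul_ne_of_not_mem`) every wall condition fails only on a COUNTABLE set of parameters (one point per place and `k : ℤ`:
the 2-block angle gap moves at rate `1`, the split slot at rate `3`); a countable subset of `ℝ` has dense complement (Mathlib `Set.Countable.dense_compl`), so every
neighbourhood of `c` contains a regular point of the line.
HONEST LABEL: HC_CM is proved only modulo the 7 printed citations (2 remaining: hLiu418 = stmt-HodgeConjecture-24832, h413 = stmt-HodgeConjecture-24833) until rung 0 closes; coordinate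
bookkeeping, pays nothing by itself.

## References
* [Shelstad1979] D. Shelstad, *Characters and inner forms of a quasi-split group over ℝ*, Compositio Math. 39 (1979), §4 p. 22 (`T^I_reg` dense open in `T`).
* [Bouaziz1994IntegralesOrbitales] A. Bouaziz, *Intégrales orbitales sur les groupes de Lie réductifs*, Ann. Sci. ÉNS 27 (1994) 573–609, §3.1 p. 579.
* [Rogawski1990] J. D. Rogawski, *Automorphic Representations of Unitary Groups in Three Variables*, Ann. of Math. Stud. 123 (1990), §8.2 p. 122.
-/

set_option autoImplicit false

noncomputable section

open Filter Topology Set Function Real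

namespace Literature.NumberTheory.Automorphic.ArchCartan

variable {W : Type*}

/-! ## §1 Angles moving at different rates -/

omit W in
/-- Off a countable set of parameters two angles moving at DIFFERENT rates never coincide on the circle: if `e^{i(a + r t)} = e^{i(b + s t)}` with `r ≠ s` then
`t = (b + 2πm − a) ∕ (r − s)` for some `m : ℤ`. [cite: Shelstad1979, §4 p. 22] -/
theorem circleExp_add_mul_ne_of_not_mem {a b r s t : ℝ} (hrs : r ≠ s) (ht : t ∉ Set.range fun m : ℤ => (b + m * (2 * π) - a) / (r - s)) :
    Circle.exp (a + r * t) ≠ Circle.exp (b + s * t) := by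
  intro h
  obtain ⟨m, hm⟩ := Circle.exp_eq_exp.1 h
  refine ht ⟨m, ?_⟩
  show (b + m * (2 * π) - a) / (r - s) = t
  rw [div_eq_iff (sub_ne_zero.2 hrs)]
  linarith

/-! ## §2 Density -/

section Dense

variable [Finite W]

/-- **`RegS S` IS DENSE** in the coordinate space (hence so is every `InRegS S ⊇ RegS S`, and `extendFrom (RegS S)` reads limits at every point). [cite: Shelstad1979, §4 p. 22]
[cite: Bouaziz1994IntegralesOrbitales, §3.1 p. 579] -/
theorem dense_regS (S : Finset W) : Dense (RegS S) := by
  haveI : Countable W := Finite.to_countable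
  intro c
  -- the line `t ↦ c + t • v`, `v w = (3, 1, 2)`, and its countable bad set
  set v : W → Fin 3 → ℝ := fun _ => ![(3 : ℝ), 1, 2] with hv
  have hslot0 : ∀ (t : ℝ) (w : W), (c + t • v) w 0 = c w 0 + 3 * t := by
    intro t w; simp only [hv, Pi.add_apply, Pi.smul_apply, smul_eq_mul, Matrix.cons_val_zero]; ring
  have hslot2 : ∀ (t : ℝ) (w : W), (c + t • v) w 2 = c w 2 + 2 * t := by
    intro t w
    simp only [hv, Pi.add_apply, Pi.smul_apply, smul_eq_mul, Matrix.cons_val_two, Matrix.tail_cons, Matrix.head_cons]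
    ring
  set B : Set ℝ := (⋃ w : W, Set.range fun m : ℤ => (c w 2 + m * (2 * π) - c w 0) / (3 - 2)) ∪ ⋃ w : W, {-(c w 0) / 3} with hB
  have hBc : B.Countable :=
    (countable_iUnion fun w => countable_range _).union (countable_iUnion fun w => countable_singleton _)
  have hgood : ∀ t : ℝ, t ∉ B → c + t • v ∈ RegS S := by
    intro t ht
    rw [hB, Set.mem_union, Set.mem_iUnion, Set.mem_iUnion, not_or, not_exists, not_exists] at ht
    refine ⟨fun w _ => ?_, fun w _ => ?_⟩
    · rw [hslot0, hslot2]
      exact circleExp_add_mul_ne_of_not_mem (by norm_num) (ht.1 w)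
    · rw [hslot0]
      intro h
      exact ht.2 w (by rw [Set.mem_singleton_iff, eq_div_iff (by norm_num : (3 : ℝ) ≠ 0)]; linarith)
  -- every neighbourhood of `c` meets the line off `B`
  rw [mem_closure_iff]
  intro o ho hco
  have hline : Continuous fun t : ℝ => c + t • v := continuous_const.add (continuous_id.smul continuous_const)
  have hpre : IsOpen ((fun t : ℝ => c + t • v) ⁻¹' o) := ho.preimage hline
  have h0 : (0 : ℝ) ∈ (fun t : ℝ => c + t • v) ⁻¹' o := by
    show c + (0 : ℝ) • v ∈ o
    rwa [zero_smul, add_zero]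
  obtain ⟨t, htB, hto⟩ := (hBc.dense_compl ℝ).exists_mem_open hpre ⟨0, h0⟩
  exact ⟨c + t • v, hto, hgood t htB⟩

/-- Every coordinate lies in the closure of `RegS S`. [cite: Shelstad1979, §4 p. 22] -/
theorem mem_closure_regS (S : Finset W) (c : W → Fin 3 → ℝ) : c ∈ closure (RegS S) :=
  (dense_regS S).closure_eq ▸ Set.mem_univ c

/-- `𝓝[RegS S] c` is non-trivial at every `c`. [cite: Shelstad1979, §4 p. 22] -/
theorem nhdsWithin_regS_neBot (S : Finset W) (c : W → Fin 3 → ℝ) : (𝓝[RegS S] c).NeBot :=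
  mem_closure_iff_nhdsWithin_neBot.1 (mem_closure_regS S c)

/-- `extendFrom (RegS S)` reads limits everywhere. [cite: Bouaziz1994IntegralesOrbitales, §3.1 p. 579] -/
theorem extendFrom_regS_eq {Y : Type*} [TopologicalSpace Y] [T2Space Y] (S : Finset W) {F : (W → Fin 3 → ℝ) → Y} {c : W → Fin 3 → ℝ} {y : Y}
    (h : Tendsto F (𝓝[RegS S] c) (𝓝 y)) : extendFrom (RegS S) F c = y :=
  extendFrom_eq (mem_closure_regS S c) h

end Dense

end Literature.NumberTheory.Automorphic.ArchCartan

end
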